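import Summits.AtomisticToContinuum.BoseEinsteinCondensation.Theorems.PeriodicIRBound.Negative.Scaling

/-!
# Negative lemmas for crux `PeriodicIRBound` (stmt-AtomisticToContinuum-3972), VIII: a `v`-uniform constant is a vanishing constant

Supports (does not close) stmt-AtomisticToContinuum-3972, route `BECGroundStateSOS`. Landed copy of
§17 of `Cruxes/PeriodicIRBound/Disproof.lean` (cycle 2, gen-2 disprover seat); all `sorry`-free,
axioms `propext`/`Classical.choice`/`Quot.sound`.

* §17 `uniformOrbitConstant_iff_vanishingConstant` — by the scaling covariance
  `(κ, ρ₀, C) ↦ (κ√b, ρ₀/b³, C√b)` (`irBoundWith_scaledPotential`, file `Scaling`), ONE constant for the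
  whole dilation orbit `{b⁻²v(·/b)}` is EQUIVALENT to EVERY constant `ε > 0` for `v` at small enough
  densities (`VanishingConstant v`: `‖k‖·n_k = o(√ρ L_N)`, the negation of Bogoliubov's
  `|p| n_p → √(πρa)`). Hence the strengthening `PeriodicIRBoundUniformC` ("`∃ C` BEFORE `v`") forces
  `VanishingConstant v` for every admissible `v` (`vanishingConstant_of_uniformC`) and is refuted by any
  infrared floor (`HasInfraredFloor`, `not_uniformC_of_floor`) — a rigorous lower bound on one low-mode
  occupation of one interacting ground state, not in print. The crux's order "`∃ C` after `v`" is
  essential and `C(b⁻²v(·/b)) = √b·C(v)` is forced along orbits.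
-/

noncomputable section

open MeasureTheory Filter
open scoped ENNReal NNReal ComplexConjugate BigOperators
namespace Summit.AtomisticToContinuum.BoseEinsteinCondensation.Theorems.PeriodicIRBound.Negative

open Literature.MathematicalPhysics.QuantumManyBody.BoseGas
open Summit.AtomisticToContinuum.BoseEinsteinCondensation.Theses.BECGroundStateSOS
open Summit.AtomisticToContinuum.BoseEinsteinCondensation.Theorems.GaussianDominationCan.Negative
  (symState symFun oneBody periodicEnergy_symState nsq nsq_nonneg e0 e0_ne_zero norm_e0
    nsq_e0 one_le_norm_intVec isRepulsiveFiniteRange_zero)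
open Summit.AtomisticToContinuum.BoseEinsteinCondensation.Theorems.CorrectorClosure.Negative
  (hardCore isRepulsiveFiniteRange_hardCore periodicEnergy_hardCore_eq_top
    periodicGroundStateEnergy_one_eq_top)
open Literature.Barriers.AtomisticToContinuum.BoseGas (scaledPotential
  isRepulsiveFiniteRange_scaledPotential scaledPotential_scaledPotential_inv)

variable {L : ℝ} {m : ℕ} {n : Fin 3 → ℤ} {a b : ℝ}

/-! ## §17 A `v`-UNIFORM constant is equivalent to a VANISHING constant (dilation orbit) -/

/-- A constant uniform along the dilation orbit `{b⁻² v(·/b) : b > 0}` of `v` (ranges `bR₀`,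
scattering lengths `b·a`): the natural strengthening "`C` independent of `v`" restricted to one
orbit. -/
def UniformOrbitConstant (v : ℝ → ℝ≥0∞) : Prop :=
  ∃ C : ℝ, 0 < C ∧ ∀ b : ℝ, 0 < b → ∀ κ : ℝ, 0 < κ → ∃ ρ₀ : ℝ, 0 < ρ₀ ∧
    IRBoundWith (scaledPotential v b) κ ρ₀ C

/-- An ARBITRARILY SMALL constant for `v` itself: `∀ ε > 0`, the bound `n_k ≤ ε√ρ L_N/‖k‖_∞` in
every window for all sufficiently small densities — i.e. `‖k‖·n_k = o(√ρ L_N)`, the NEGATION of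
Bogoliubov's `|p|·n_p → √(πρa)` (`p → 0`). -/
def VanishingConstant (v : ℝ → ℝ≥0∞) : Prop :=
  ∀ ε : ℝ, 0 < ε → ∀ κ : ℝ, 0 < κ → ∃ ρ₀ : ℝ, 0 < ρ₀ ∧ IRBoundWith v κ ρ₀ ε

/-- **Uniform-in-`v` constant ⟺ vanishing constant.** Along a dilation orbit the scaling
covariance `(κ, ρ₀, C) ↦ (κ√b, ρ₀/b³, C√b)` (`irBoundWith_scaledPotential`) trades the constant
against the dilation parameter, so ONE constant for all `b⁻²v(·/b)` is exactly the same as EVERY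
constant `ε > 0` for `v` (at `ε`-dependent densities). Bogoliubov (`n_p ≈ √(πρa)/|p|` at the
bottom of the window, Gavoret–Nozières exact infrared law) says the right side is false for every
genuinely interacting `v`; so the crux's order "`∃ C` AFTER `v`" is essential and
`C(b⁻²v(·/b)) = √b·C(v)` is forced — but a PROOF of `¬ VanishingConstant v` for a single
admissible `v` is a rigorous lower bound on a low-mode occupation of an interacting ground state,
which is not in print (it is the content of the sibling crux `InfraredMinimumUncertainty`,
stmt-11784, in another normalisation). [folklore] -/
theorem uniformOrbitConstant_iff_vanishingConstant (v : ℝ → ℝ≥0∞) :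
    UniformOrbitConstant v ↔ VanishingConstant v := by
  constructor
  · rintro ⟨C, hC, h⟩ ε hε κ hκ
    -- dilate by `b = (C/ε)²`, so that `C/√b = ε`
    set b : ℝ := (C / ε) ^ 2 with hb
    have hb0 : 0 < b := by positivity
    have hsb : Real.sqrt b = C / ε := by rw [hb, Real.sqrt_sq (by positivity)]
    obtain ⟨ρ₀, hρ₀, h⟩ := h b hb0 (κ * Real.sqrt b) (by positivity)
    have key := irBoundWith_scaledPotential (inv_pos.2 hb0) h
    rw [scaledPotential_scaledPotential_inv hb0] at key
    refine ⟨ρ₀ / b⁻¹ ^ 3, by positivity, ?_⟩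
    have h1 : κ * Real.sqrt b * Real.sqrt b⁻¹ = κ := by
      rw [Real.sqrt_inv, mul_assoc, mul_inv_cancel₀ (Real.sqrt_pos.2 hb0).ne', mul_one]
    have h2 : C * Real.sqrt b⁻¹ = ε := by
      rw [Real.sqrt_inv, hsb, inv_div, mul_div_assoc', mul_comm, mul_div_assoc,
        div_self hC.ne', mul_one]
    rwa [h1, h2] at key
  · intro h
    refine ⟨1, one_pos, fun b hb κ hκ => ?_⟩
    obtain ⟨ρ₀, hρ₀, h⟩ := h (Real.sqrt b)⁻¹ (by positivity) (κ / Real.sqrt b) (by positivity)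
    have key := irBoundWith_scaledPotential hb h
    have hs : (0 : ℝ) < Real.sqrt b := Real.sqrt_pos.2 hb
    rw [div_mul_cancel₀ κ hs.ne', inv_mul_cancel₀ hs.ne'] at key
    exact ⟨ρ₀ / b ^ 3, by positivity, key⟩

/-- The strengthening of the crux with the constant chosen BEFORE the potential:
`∃ C > 0, ∀ v admissible, ∀ κ > 0, ∃ ρ₀ > 0, …` (window-dependence of `ρ₀` kept). -/
def PeriodicIRBoundUniformC : Prop :=
  ∃ C : ℝ, 0 < C ∧ ∀ v : ℝ → ℝ≥0∞, IsRepulsiveFiniteRange v → ∀ κ : ℝ, 0 < κ →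
    ∃ ρ₀ : ℝ, 0 < ρ₀ ∧ IRBoundWith v κ ρ₀ C

/-- **A `v`-uniform constant forces a vanishing constant for EVERY admissible `v`** (the orbit of
an admissible `v` is admissible, `isRepulsiveFiniteRange_scaledPotential`). So
`PeriodicIRBoundUniformC` is refuted by any rigorous lower bound `‖k‖·γ_N(k) ≥ c√ρ L_N` at one
mode of the window, for one interacting admissible `v`, along a sequence of `N` at arbitrarily
small `ρ` (`not_uniformC_of_floor`) — none is available today. [folklore] -/
theorem vanishingConstant_of_uniformC (h : PeriodicIRBoundUniformC) {v : ℝ → ℝ≥0∞}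
    (hv : IsRepulsiveFiniteRange v) : VanishingConstant v := by
  obtain ⟨C, hC, h⟩ := h
  exact (uniformOrbitConstant_iff_vanishingConstant v).1
    ⟨C, hC, fun b hb κ hκ => h _ (isRepulsiveFiniteRange_scaledPotential hv hb) κ hκ⟩

/-- An **infrared floor** for `v`: some window `κ`, some `c > 0` such that at arbitrarily small
densities, frequently in `N`, for every slack, some near-minimiser has some mode of the window with
`n_k > c√ρ L_N/‖k‖_∞` — the (expected, unproved) Bogoliubov/Pitaevskii–Stringari lower bound in
the crux's normalisation; this is `¬ VanishingConstant v` unfolded (`not_vanishingConstant_iff`). -/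
def HasInfraredFloor (v : ℝ → ℝ≥0∞) : Prop :=
  ∃ c : ℝ, 0 < c ∧ ∃ κ : ℝ, 0 < κ ∧ ∀ ρ₀ : ℝ, 0 < ρ₀ → ∃ ρ : ℝ, 0 < ρ ∧ ρ < ρ₀ ∧
    ∃ᶠ N : ℕ in atTop, ∀ δ : ℝ≥0∞, 0 < δ → ∃ Ψ : PeriodicTrialState N (sideLength ρ N),
      NearMin v ρ N δ Ψ ∧ ∃ k : Fin 3 → ℤ, InWindow κ ρ N k ∧ ¬ IRIneq c ρ N Ψ.ψ k

/-- `HasInfraredFloor v ↔ ¬ VanishingConstant v` (pure logic). [folklore] -/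
theorem hasInfraredFloor_iff_not_vanishingConstant (v : ℝ → ℝ≥0∞) :
    HasInfraredFloor v ↔ ¬ VanishingConstant v := by
  unfold HasInfraredFloor VanishingConstant IRBoundWith
  push Not
  exact Iff.rfl

/-- **`PeriodicIRBoundUniformC` is false as soon as ONE admissible potential has an infrared
floor** — the negative lemma for the strengthening, modulo the missing lower bound. [folklore] -/
theorem not_uniformC_of_floor {v : ℝ → ℝ≥0∞} (hv : IsRepulsiveFiniteRange v)
    (hfloor : HasInfraredFloor v) : ¬ PeriodicIRBoundUniformC := fun h =>
  (hasInfraredFloor_iff_not_vanishingConstant v).1 hfloor (vanishingConstant_of_uniformC h hv)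

end Summit.AtomisticToContinuum.BoseEinsteinCondensation.Theorems.PeriodicIRBound.Negative

end
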